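import Mathlib
import HarnessLib

/-!
# KL versus `χ²`: `0 ≤ D(P‖Q) ≤ log(1 + χ²(P‖Q)) ≤ χ²(P‖Q)` (finite laws)

[cite: PolyanskiyWu2024, §7.7 eq. (7.34)] ("KL versus `χ²`: `0 ≤ D(P‖Q) ≤ log(1 + χ²(P‖Q)) ≤
log e · χ²(P‖Q)`"), in nats, for laws on a finite set written as functions: `P ≥ 0` and `Q > 0`
with total mass `1`, `D(P‖Q) = Σ_x P(x) log(P(x)/Q(x))` (the finite sum of `PinskerInequality.lean`)
and `χ²(P‖Q) = Σ_x (P(x) − Q(x))²/Q(x)` (`chiSqSum`; `1 + χ² = Σ_x P(x)²/Q(x)`).  The middle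
inequality is Jensen's inequality for the concave `log` under the law `P` (restricted to the
support of `P`); the last one is `log(1 + u) ≤ u`.  Everything is proved; 0 named facts.
(Use: an `ℓ²(π)`-distance bound `‖h − 1‖²_{2,π} = χ²` for a Markov chain gives an entropy bound.)
-/

namespace Literature.Probability.Entropy

open Finset Real

variable {X : Type*} [Fintype X]

/-- The `χ²`-divergence of finite laws, `χ²(P‖Q) = Σ_x (P(x) − Q(x))²/Q(x)`.
[cite: PolyanskiyWu2024, §7.1 (the `f`-divergence with `f(x) = (x − 1)²`)] -/
noncomputable def chiSqSum (P Q : X → ℝ) : ℝ := ∑ x, (P x - Q x) ^ 2 / Q x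

/-- `χ² ≥ 0` for `Q > 0`. [cite: PolyanskiyWu2024, §7.1] -/
theorem chiSqSum_nonneg {P Q : X → ℝ} (hQ : ∀ x, 0 < Q x) : 0 ≤ chiSqSum P Q :=
  sum_nonneg fun x _ => div_nonneg (sq_nonneg _) (hQ x).le

/-- `1 + χ²(P‖Q) = Σ_x P(x)²/Q(x)` for laws of mass one. [cite: PolyanskiyWu2024, §7.1] -/
theorem one_add_chiSqSum {P Q : X → ℝ} (hP1 : ∑ x, P x = 1) (hQ : ∀ x, 0 < Q x)
    (hQ1 : ∑ x, Q x = 1) : 1 + chiSqSum P Q = ∑ x, P x ^ 2 / Q x := by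
  unfold chiSqSum
  have e : ∀ x, (P x - Q x) ^ 2 / Q x = P x ^ 2 / Q x - 2 * P x + Q x := fun x => by
    have hq := (hQ x).ne'
    field_simp
    ring
  simp_rw [e]
  rw [sum_add_distrib, sum_sub_distrib, ← mul_sum, hP1, hQ1]
  ring

/-- **`D(P‖Q) ≤ log(1 + χ²(P‖Q))`** (Jensen for `log` under `P`). [cite: PolyanskiyWu2024, §7.7
eq. (7.34)] -/
theorem kl_le_log_one_add_chiSqSum [DecidableEq X] {P Q : X → ℝ} (hP : ∀ x, 0 ≤ P x)
    (hP1 : ∑ x, P x = 1) (hQ : ∀ x, 0 < Q x) (hQ1 : ∑ x, Q x = 1) :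
    ∑ x, P x * Real.log (P x / Q x) ≤ Real.log (1 + chiSqSum P Q) := by
  rw [one_add_chiSqSum hP1 hQ hQ1]
  -- restrict to the support `S = {P ≠ 0}`
  set S := univ.filter fun x => P x ≠ 0 with hS
  have hPS : ∀ x ∈ S, 0 < P x := fun x hx => by
    have h := (mem_filter.1 hx).2
    exact lt_of_le_of_ne (hP x) (Ne.symm h)
  have hsumS : ∑ x ∈ S, P x = 1 := by
    rw [← hP1, hS, sum_filter_ne_zero]
  have hlhs : ∑ x, P x * Real.log (P x / Q x) = ∑ x ∈ S, P x * Real.log (P x / Q x) := by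
    rw [hS, sum_filter]
    exact sum_congr rfl fun x _ => by by_cases h : P x = 0 <;> simp [h]
  have hrhs : ∑ x ∈ S, P x * (P x / Q x) ≤ ∑ x, P x ^ 2 / Q x := by
    have e : ∀ x, P x * (P x / Q x) = P x ^ 2 / Q x := fun x => by ring
    simp_rw [e]
    exact sum_le_sum_of_subset_of_nonneg (filter_subset _ _)
      fun x _ _ => div_nonneg (sq_nonneg _) (hQ x).le
  -- Jensen: `Σ_S P log(P/Q) ≤ log(Σ_S P · P/Q)`
  have hJ : ∑ x ∈ S, P x • Real.log (P x / Q x) ≤ Real.log (∑ x ∈ S, P x • (P x / Q x)) :=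
    (strictConcaveOn_log_Ioi.concaveOn).le_map_sum (fun x hx => (hPS x hx).le) hsumS
      fun x hx => Set.mem_Ioi.2 (div_pos (hPS x hx) (hQ x))
  simp only [smul_eq_mul] at hJ
  have hpos : 0 < ∑ x ∈ S, P x * (P x / Q x) := by
    -- `S` is nonempty since `Σ P = 1`
    have hne : S.Nonempty := by
      by_contra h
      rw [not_nonempty_iff_eq_empty] at h
      rw [h, sum_empty] at hsumS
      exact zero_ne_one hsumS
    exact sum_pos (fun x hx => mul_pos (hPS x hx) (div_pos (hPS x hx) (hQ x))) hne
  rw [hlhs]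
  exact hJ.trans (Real.log_le_log hpos hrhs)

/-- **`D(P‖Q) ≤ χ²(P‖Q)`** (`log(1 + u) ≤ u`). [cite: PolyanskiyWu2024, §7.7 eq. (7.34)] -/
theorem kl_le_chiSqSum [DecidableEq X] {P Q : X → ℝ} (hP : ∀ x, 0 ≤ P x) (hP1 : ∑ x, P x = 1)
    (hQ : ∀ x, 0 < Q x) (hQ1 : ∑ x, Q x = 1) :
    ∑ x, P x * Real.log (P x / Q x) ≤ chiSqSum P Q := by
  refine (kl_le_log_one_add_chiSqSum hP hP1 hQ hQ1).trans ?_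
  have h0 := chiSqSum_nonneg (P := P) hQ
  have := Real.log_le_sub_one_of_pos (by linarith : 0 < 1 + chiSqSum P Q)
  linarith

end Literature.Probability.Entropy
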